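import Literature.NumberTheory.EllipticCurves.Kato2004.DefinedExpStarBodyScalingProofs
import Literature.NumberTheory.EllipticCurves.Kato2004.CyclotomicLevelCompletions
import Literature.NumberTheory.AdelicBaseChange.PadicTensorCompletionProofs
import Literature.NumberTheory.AdelicBaseChange.PadicTensorCompletionGaloisProofs
import Mathlib.NumberTheory.NumberField.Cyclotomic.Ideal
import HarnessLib

set_option autoImplicit false

/-!
# The DEFINED dual-exponential value datum of `Kato2004.DefinedExpStarBody` is RIGID on the `p`-power levels: two data
# `(d, Λ)` and `(e•d, Λ')` of `(W, p)` have `Λ' k ∅ = e⁻¹ • Λ k ∅` (display (U) of the PR-INV lane; Kato LNM 1553 II §1.2.4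
# «`exp*_{e•ω} = e⁻¹·exp*_ω`»; Bloch–Kato 1990 Def. 3.10 — the dual exponential is canonical)
# (seat `bsd-cm-prr-ty1` g14, cell `bsd-cm`; theorems only: no definition, no named fact, no instance, no `sorry`)

Part 39 of the seat's kernel cut of stub 3 of the Kato–Perrin-Riou skeletons v4 (cruxes stmt-BirchSwinnertonDyer-19945 / -19223);
OFFER (Q) of the seat, GO by planner D561.  Part 38 (`KatoDescentPerrinRiouRatioUnitOfFacts`, E25) reduced the display PR-INV of
stub 3 to `IsNewformOf.level_eq_conductorNorm` + two displays UNIT and KATO-RIGID; UNIT's print content is «the dual exponential is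
canonical, so two Tate-normalised Néron coordinates give value maps proportional by a `p`-adic unit».  THIS FILE proves its kernel
half (U): for two data `(d, ι, κ, Λ)` and `(d.smul e he, ι', κ', Λ')` both satisfying the (RES)/(DEF) clauses of
`Kato2004.DefinedExpStarBody W p f · · · ·` (`Kato2004/EulerSystemDefinedValues.lean`), and ONE continuous cocycle of `Γ_{ℚ_v}` on which
`exp*_d` does not vanish (the non-degeneracy that (Z2) of `Kato2004.PRRatioBody` supplies — next file), the value maps satisfy
**`Λ' k ∅ y = ẽ⁻¹ • Λ k ∅ y`** for every `p`-power level `k` and every class `y` (`ẽ` = `e` read in `ℚ_[p]` along Mathlib's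
`ℚ_[p] ≃ ℚ_v`).  MECHANISM (`definedExpStarBody_smul_apply_eq`, §3):
* ONE PLACE over `p` in `ℚ(ζ_{p^k})` (§1, `subsingleton_extension_cyclotomicField_primePow`: Mathlib
  `IsCyclotomicExtension.Rat.eq_span_zeta_sub_one_of_liesOver` for `k ≥ 1`, the fundamental identity with `[ℚ(ζ_1) : ℚ] = 1` for
  `k = 0`), so the existential `(w₀, g, d_{w₀})` of (DEF) lives at the same completion `L_{w₀}` for both data, with the same
  quantified local-field structure proofs (the fact quantifies them for exactly this purpose);
* g-ELIMINATION (§3): (DEF) reads `Ψ(Λ y)_{w₀} = σ̃_{g}⁻¹ (exp*_{d_{w₀}} ψT(g·Y))` through a twist `g = g w₀` with `σ_g • w₀ = w₀`; applied to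
  `Y = g⁻¹·y`, the GLOBAL equivariance (C3a) of a `ZetaBody` family of the datum (its last conjunct at the guarded parameters
  `(c, d, a, A) = (1, 1, 0, 1)`) and `Ψ ∘ (1 ⊗ σ) = σ̃ ∘ Ψ` (`AdelicBaseChange.padicTensor_map_galois`) give
  `Ψ(Λ y)_{w₀} = exp*_{d_{w₀}}(ψT(y))` for BOTH data with the SAME tower cocycle `ψT` of `y` (§2);
* the two tower generators `d_{w₀}, d'_{w₀}` of the `L_{w₀}`-line `D⁰_dR` differ by a scalar `μ` (`FilZeroLine.exists_ne_zero_and_eq_smul`),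
  `exp*_{μ•ω} = μ⁻¹ exp*_ω` (`FilZeroLine.dualExpCoord_smul`), and (RES) for both data on the restriction of the non-degenerate cocycle,
  with `exp*_{e•d} = e⁻¹ exp*_d` (`expStarCoord_smul_generator`), pins `μ = e`;
* `Ψ(s • t) = ŝ · Ψ(t)` (`padicTensor_map_smul`), the single place, and the injectivity of `Ψ` finish.
HONEST LABEL: a theorem about the tree's READING (RES)/(DEF) of Kato's `exp*` — nothing about Kato's classes, their values, Kato's Main
Conjecture or Perrin-Riou's conjecture is asserted; the named facts `exists_eulerSystem_definedExpStar_values` /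
`exists_eulerSystem_expStar_values` are NOT used (the data are hypotheses); no stub is closed; nothing is asserted on 19945 / 19223;
no summit statement is proved; BSD is not proved for any curve.
References: [Kato1993LNM1553] Ch. II §1.2.4, Ex. 1.3.5; [BlochKato1990] Def. 3.10, Prop. 3.8; [Kato2004Asterisque] §9.4 (p. 188), Thm. 9.7
(p. 189); [CasselsFrohlichANT1967] Ch. II §10 (10.2), Ch. VII §1.1; [Washington1997] Prop. 2.3, Lemma 1.4 (one prime over `p` in
`ℚ(ζ_{p^k})`, totally ramified); [NeukirchANT1999] Ch. II §9 (9.6).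
-/

noncomputable section

open scoped BigOperators NumberField TensorProduct Pointwise
open Polynomial Field IsDedekindDomain NumberField CongruenceSubgroup ValuativeRel
open Literature.NumberTheory.GaloisRepresentations
open Literature.NumberTheory.GaloisRepresentations.PeriodRingData
open Literature.NumberTheory.GaloisRepresentations.IsNonarchimedeanLocalField
open Literature.NumberTheory.PAdicHodge
open Literature.NumberTheory.EllipticCurves Literature.NumberTheory.EllipticCurves.ModularForms
open Literature.NumberTheory.AdelicBaseChange Literature.NumberTheory.Automorphic
open Literature.NumberTheory.EllipticCurves.Kato2004 Literature.NumberTheory.EllipticCurves.Kato2004.EulerSystemValues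
open Rat.HeightOneSpectrum

namespace Summit.BirchSwinnertonDyer.Rank1Residual.Additive.PerrinRiouUnit

/-! ## §1 One place over `p` in `ℚ(ζ_{p^k})` -/

section Place

variable (p : ℕ) [hp : Fact p.Prime]

set_option backward.isDefEq.respectTransparency false in
/-- A prime of `𝓞 L` over the place `v_p` of `𝓞 ℚ` lies over `(p) ⊂ ℤ`. [cite: NeukirchANT1999, Ch. II §9 Prop. (9.6)] -/
theorem liesOver_span_of_extension {L : Type*} [Field L] [NumberField L]
    (w : (((Rat.HeightOneSpectrum.primesEquiv (R := 𝓞 ℚ)).symm ⟨p, Fact.out⟩)).Extension (𝓞 L)) :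
    w.1.asIdeal.LiesOver (Ideal.span {(p : ℤ)}) := by
  refine ⟨?_⟩
  have hpw : ((p : ℕ) : 𝓞 L) ∈ w.1.asIdeal :=
    natCast_mem_asIdeal_of_extension p _ ((natCast_mem_asIdeal_iff_eq_primesEquiv_symm _ (Fact.out : p.Prime)).mpr rfl) w
  have hmax : (Ideal.span {(p : ℤ)}).IsMaximal :=
    PrincipalIdealRing.isMaximal_of_irreducible (Int.prime_iff_natAbs_prime.mpr (by simpa using hp.out)).irreducible
  refine (hmax.eq_of_le ?_ ?_)
  · exact Ideal.comap_ne_top _ w.1.isPrime.ne_top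
  · rw [Ideal.span_singleton_le_iff_mem, Ideal.mem_comap, map_natCast]
    exact hpw

set_option backward.isDefEq.respectTransparency false in
/-- **`ℚ(ζ_{p^k})` has exactly ONE place over `p`** (`p` is totally ramified: Mathlib
`IsCyclotomicExtension.Rat.eq_span_zeta_sub_one_of_liesOver` for `k ≥ 1`; for `k = 0` the field is `ℚ`).  Stated on the tree's
type of extensions of `v_p` to `𝓞 (CyclotomicField (cycLevel p k ∅) ℚ)` (the index type of the semi-local product in (DEF) of
`Kato2004.DefinedExpStarBody`). [cite: Washington1997, Lemma 1.4 and Prop. 2.3] -/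
theorem subsingleton_extension_cyclotomicField_primePow (k : ℕ) :
    Subsingleton ((((Rat.HeightOneSpectrum.primesEquiv (R := 𝓞 ℚ)).symm ⟨p, Fact.out⟩)).Extension
      (𝓞 (CyclotomicField (cycLevel p k ∅) ℚ))) := by
  have hlev : cycLevel p k ∅ = p ^ k := by simp [cycLevel]
  refine ⟨fun w w' => Subtype.ext (HeightOneSpectrum.ext ?_)⟩
  haveI := liesOver_span_of_extension p w
  haveI := liesOver_span_of_extension p w'
  rcases Nat.eq_zero_or_pos k with rfl | hk
  · -- `k = 0`: `ℚ(ζ_1) = ℚ`, one prime over `p` by the fundamental identity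
    haveI : IsGalois ℚ (CyclotomicField (cycLevel p 0 ∅) ℚ) := IsCyclotomicExtension.isGalois {cycLevel p 0 ∅} ℚ _
    have hfin : Module.finrank ℚ (CyclotomicField (cycLevel p 0 ∅) ℚ) = 1 := by
      rw [IsCyclotomicExtension.finrank (n := cycLevel p 0 ∅) (CyclotomicField (cycLevel p 0 ∅) ℚ)
        (cyclotomic.irreducible_rat (NeZero.pos _))]
      simp [cycLevel]
    have h_main := Ideal.ncard_primesOver_mul_ramificationIdxIn_mul_inertiaDegIn (Ideal.span {(p : ℤ)})
      (𝓞 (CyclotomicField (cycLevel p 0 ∅) ℚ)) Gal(CyclotomicField (cycLevel p 0 ∅) ℚ/ℚ)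
    rw [IsGaloisGroup.card_eq_finrank Gal(CyclotomicField (cycLevel p 0 ∅) ℚ/ℚ) ℚ (CyclotomicField (cycLevel p 0 ∅) ℚ),
      hfin] at h_main
    have hone : ((Ideal.span {(p : ℤ)}).primesOver (𝓞 (CyclotomicField (cycLevel p 0 ∅) ℚ))).ncard = 1 :=
      Nat.eq_one_of_mul_eq_one_right h_main
    obtain ⟨P, hP⟩ := Set.ncard_eq_one.mp hone
    have h1 : w.1.asIdeal ∈ (Ideal.span {(p : ℤ)}).primesOver (𝓞 (CyclotomicField (cycLevel p 0 ∅) ℚ)) :=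
      ⟨w.1.isPrime, inferInstance⟩
    have h2 : w'.1.asIdeal ∈ (Ideal.span {(p : ℤ)}).primesOver (𝓞 (CyclotomicField (cycLevel p 0 ∅) ℚ)) :=
      ⟨w'.1.isPrime, inferInstance⟩
    rw [hP, Set.mem_singleton_iff] at h1 h2
    rw [h1, h2]
  · obtain ⟨j, rfl⟩ := Nat.exists_eq_add_of_le' hk
    haveI : IsCyclotomicExtension {p ^ (j + 1)} ℚ (CyclotomicField (cycLevel p (j + 1) ∅) ℚ) := by
      rw [← hlev]; infer_instance
    have hζ := IsCyclotomicExtension.zeta_spec (p ^ (j + 1)) ℚ (CyclotomicField (cycLevel p (j + 1) ∅) ℚ)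
    haveI := w.1.isPrime
    haveI := w'.1.isPrime
    rw [IsCyclotomicExtension.Rat.eq_span_zeta_sub_one_of_liesOver p j (CyclotomicField (cycLevel p (j + 1) ∅) ℚ) hζ w.1.asIdeal,
      IsCyclotomicExtension.Rat.eq_span_zeta_sub_one_of_liesOver p j (CyclotomicField (cycLevel p (j + 1) ∅) ℚ) hζ w'.1.asIdeal]

end Place

/-! ## §2 Restricted and tower cocycles (plumbing) -/

section Cocycles

/-- **Restriction of a continuous crossed homomorphism along a continuous group homomorphism** (Serre, *Galois Cohomology* I §2.4:
compatible pairs): `σ ↦ η(φ σ)` is a continuous cocycle of the restricted representation. [cite: SerreGaloisCohomology1997, I §2.4] -/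
theorem exists_cocycle_restrict {G H : Type} [Group G] [TopologicalSpace G] [IsTopologicalGroup G] [Group H] [TopologicalSpace H]
    [IsTopologicalGroup H] {A M : Type} [CommRing A] [TopologicalSpace A] [AddCommGroup M] [Module A M] [TopologicalSpace M]
    [IsTopologicalAddGroup M] [ContinuousSMul A M]
    (ρ : ContinuousRep G A M) (φ : H →ₜ* G) (η : contOneCocycles ρ.toTopRep) :
    ∃ η' : contOneCocycles (ρ.restrict φ).toTopRep, ∀ σ, η'.1 σ = η.1 (φ σ) := by
  refine ⟨⟨η.1.comp (φ : C(H, G)), fun g h => ?_⟩, fun σ => rfl⟩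
  change η.1 (φ (g * h)) = η.1 (φ g) + (ρ.restrict φ).toTopRep.ρ g (η.1 (φ h))
  rw [map_mul, η.2]
  rfl

variable (W : WeierstrassCurve ℚ) [W.IsElliptic] (p : ℕ) [Fact p.Prime] [ContinuousSMul ℤ_[p] (W.tateModule p)]

set_option backward.isDefEq.respectTransparency false in
/-- **The tower cocycle of a level cocycle at a completion above `p`**: for a continuous crossed homomorphism `φ` of
`Gal(ℚ̄/ℚ(μ_{p^k}))` with values in `T_pW` and a place `w ∣ p` of `ℚ(ζ_{p^k})`, `σ ↦ φ(res^{tower} σ)` is a continuous cocycle of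
`Γ_{ℚ(ζ)_w}` for `T_pW|_{Γ_{ℚ_v}}|_{Γ_{ℚ(ζ)_w}}` (the tower restriction lands in the level subgroup:
`absGaloisRestrictTower_cyclotomicField_adicCompletion_mem_cycSubgroup`) — the object `ψT` of (DEF) of `Kato2004.DefinedExpStarBody`.
[cite: SerreGaloisCohomology1997, I §2.4] [cite: Rubin2000, Ch. III §2.1] -/
theorem exists_towerCocycle (k : ℕ)
    (w₀ : ((Rat.HeightOneSpectrum.primesEquiv (R := 𝓞 ℚ)).symm ⟨p, Fact.out⟩).Extension (𝓞 (CyclotomicField (cycLevel p k ∅) ℚ)))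
    (φ : contOneCocycles (subgroupRep (tateRep W p).toTopRep (cycSubgroup p k ∅))) :
    ∃ ψT : contOneCocycles ((restrictedTateRep W (NumberField.Place.Completion (Sum.inr ((Rat.HeightOneSpectrum.primesEquiv (R := 𝓞 ℚ)).symm ⟨p, Fact.out⟩) : NumberField.Place ℚ)) p).restrict
        (absGaloisRestrict (((Rat.HeightOneSpectrum.primesEquiv (R := 𝓞 ℚ)).symm ⟨p, Fact.out⟩).adicCompletion ℚ) (w₀.1.adicCompletion (CyclotomicField (cycLevel p k ∅) ℚ)))).toTopRep,
      ∀ σ, ψT.1 σ = φ.1 ⟨absGaloisRestrictTower ℚ (((Rat.HeightOneSpectrum.primesEquiv (R := 𝓞 ℚ)).symm ⟨p, Fact.out⟩).adicCompletion ℚ) (w₀.1.adicCompletion (CyclotomicField (cycLevel p k ∅) ℚ)) σ,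
        absGaloisRestrictTower_cyclotomicField_adicCompletion_mem_cycSubgroup p k ∅ ((Rat.HeightOneSpectrum.primesEquiv (R := 𝓞 ℚ)).symm ⟨p, Fact.out⟩) w₀ σ⟩ := by
  refine ⟨⟨⟨fun σ => φ.1 ⟨absGaloisRestrictTower ℚ (((Rat.HeightOneSpectrum.primesEquiv (R := 𝓞 ℚ)).symm ⟨p, Fact.out⟩).adicCompletion ℚ) (w₀.1.adicCompletion (CyclotomicField (cycLevel p k ∅) ℚ)) σ,
      absGaloisRestrictTower_cyclotomicField_adicCompletion_mem_cycSubgroup p k ∅ ((Rat.HeightOneSpectrum.primesEquiv (R := 𝓞 ℚ)).symm ⟨p, Fact.out⟩) w₀ σ⟩, ?_⟩, fun g h => ?_⟩, fun σ => rfl⟩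
  · exact φ.1.continuous.comp (absGaloisRestrictTowerInto ℚ (((Rat.HeightOneSpectrum.primesEquiv (R := 𝓞 ℚ)).symm ⟨p, Fact.out⟩).adicCompletion ℚ) (w₀.1.adicCompletion (CyclotomicField (cycLevel p k ∅) ℚ)) (cycSubgroup p k ∅)
      (absGaloisRestrictTower_cyclotomicField_adicCompletion_mem_cycSubgroup p k ∅ ((Rat.HeightOneSpectrum.primesEquiv (R := 𝓞 ℚ)).symm ⟨p, Fact.out⟩) w₀)).continuous
  · change φ.1 (absGaloisRestrictTowerInto ℚ (((Rat.HeightOneSpectrum.primesEquiv (R := 𝓞 ℚ)).symm ⟨p, Fact.out⟩).adicCompletion ℚ) (w₀.1.adicCompletion (CyclotomicField (cycLevel p k ∅) ℚ)) (cycSubgroup p k ∅)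
      (absGaloisRestrictTower_cyclotomicField_adicCompletion_mem_cycSubgroup p k ∅ ((Rat.HeightOneSpectrum.primesEquiv (R := 𝓞 ℚ)).symm ⟨p, Fact.out⟩) w₀) (g * h)) = _
    rw [map_mul, φ.2]
    rfl

end Cocycles

/-! ## §3 (U): rigidity of the defined value datum on the `p`-power levels -/

section Rigid

set_option backward.isDefEq.respectTransparency false in
set_option maxHeartbeats 8000000 in
/-- **(U) — two DEFINED dual-exponential data `(d, Λ)` and `(e•d, Λ')` of `(W, p)` have `Λ' k ∅ = ẽ⁻¹ • Λ k ∅` on every `p`-power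
level** (module docstring), granted one continuous cocycle of `Γ_{ℚ_v}` with `exp*_d ≠ 0`.  The `letI` chain is that of
`Kato2004.DefinedExpStarBody`'s binder `d`, verbatim (so that `d.smul` elaborates against the same structures, as in
`Kato2004.definedExpStarBody_units_smul`).  Nothing about Kato's classes is asserted.
[cite: Kato1993LNM1553, Ch. II §1.2.4 and Ex. 1.3.5] [cite: BlochKato1990, Def. 3.10] [cite: Kato2004Asterisque, §9.4 (p. 188)]
[cite: CasselsFrohlichANT1967, Ch. II §10 Theorem (10.2) and Ch. VII §1.1] -/
theorem definedExpStarBody_smul_apply_eq (W : WeierstrassCurve ℚ) [W.IsElliptic] (p : ℕ) [Fact p.Prime]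
    [ContinuousSMul ℤ_[p] (W.tateModule p)] [Module.Free ℤ_[p] (W.tateModule p)]
    [Module.Finite ℤ_[p] (W.tateModule p)]
    {N₁ : ℕ} [NeZero N₁] (f₁ : CuspForm (Gamma0 N₁) 2) {N₂ : ℕ} [NeZero N₂] (f₂ : CuspForm (Gamma0 N₂) 2) {d : _}
    (ι₁ ι₂ : (n : ℕ) → (CyclotomicField n ℚ →+* ℂ)) (κ₁ κ₂ : ℝ)
    (Λ₁ Λ₂ : ∀ (k' : ℕ) (r : Finset (HeightOneSpectrum (𝓞 ℚ))),
      H1 (tateRep W p) (cycSubgroup p k' r) →ₗ[ℤ_[p]] ℚ_[p] ⊗[ℚ] CyclotomicField (cycLevel p k' r) ℚ)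
    (e : NumberField.Place.Completion (Sum.inr ((Rat.HeightOneSpectrum.primesEquiv (R := 𝓞 ℚ)).symm ⟨p, Fact.out⟩) : NumberField.Place ℚ))
    (he : e ≠ 0)
    (h₁ : Kato2004.DefinedExpStarBody W p f₁ d ι₁ κ₁ Λ₁) :
    letI ρT := restrictedTateRep W (NumberField.Place.Completion (Sum.inr ((Rat.HeightOneSpectrum.primesEquiv (R := 𝓞 ℚ)).symm ⟨p, Fact.out⟩) : NumberField.Place ℚ)) p
    letI : ValuativeRel (NumberField.Place.Completion (Sum.inr ((Rat.HeightOneSpectrum.primesEquiv (R := 𝓞 ℚ)).symm ⟨p, Fact.out⟩) : NumberField.Place ℚ)) :=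
      inferInstanceAs (ValuativeRel (((Rat.HeightOneSpectrum.primesEquiv (R := 𝓞 ℚ)).symm ⟨p, Fact.out⟩).adicCompletion ℚ))
    letI : TopologicalSpace (NumberField.Place.Completion (Sum.inr ((Rat.HeightOneSpectrum.primesEquiv (R := 𝓞 ℚ)).symm ⟨p, Fact.out⟩) : NumberField.Place ℚ)) :=
      inferInstanceAs (TopologicalSpace (((Rat.HeightOneSpectrum.primesEquiv (R := 𝓞 ℚ)).symm ⟨p, Fact.out⟩).adicCompletion ℚ))
    haveI : IsNonarchimedeanLocalField (NumberField.Place.Completion (Sum.inr ((Rat.HeightOneSpectrum.primesEquiv (R := 𝓞 ℚ)).symm ⟨p, Fact.out⟩) : NumberField.Place ℚ)) :=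
      inferInstanceAs (IsNonarchimedeanLocalField (((Rat.HeightOneSpectrum.primesEquiv (R := 𝓞 ℚ)).symm ⟨p, Fact.out⟩).adicCompletion ℚ))
    haveI : CharZero (NumberField.Place.Completion (Sum.inr ((Rat.HeightOneSpectrum.primesEquiv (R := 𝓞 ℚ)).symm ⟨p, Fact.out⟩) : NumberField.Place ℚ)) := LocalField.charZero_adicCompletion ((Rat.HeightOneSpectrum.primesEquiv (R := 𝓞 ℚ)).symm ⟨p, Fact.out⟩)
    letI : Algebra ℚ_[p] (NumberField.Place.Completion (Sum.inr ((Rat.HeightOneSpectrum.primesEquiv (R := 𝓞 ℚ)).symm ⟨p, Fact.out⟩) : NumberField.Place ℚ)) :=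
      LocalField.adicCompletionPadicAlgebra ((Rat.HeightOneSpectrum.primesEquiv (R := 𝓞 ℚ)).symm ⟨p, Fact.out⟩) p ((natCast_mem_asIdeal_iff_eq_primesEquiv_symm _ (Fact.out : p.Prime)).mpr rfl)
    haveI : Fact (¬ IsUnit ((p : ℕ) : integerC (NumberField.Place.Completion (Sum.inr ((Rat.HeightOneSpectrum.primesEquiv (R := 𝓞 ℚ)).symm ⟨p, Fact.out⟩) : NumberField.Place ℚ)))) :=
      ⟨not_isUnit_natCast_integerC (show valuation (NumberField.Place.Completion (Sum.inr ((Rat.HeightOneSpectrum.primesEquiv (R := 𝓞 ℚ)).symm ⟨p, Fact.out⟩) : NumberField.Place ℚ)) ((p : ℕ) : (NumberField.Place.Completion (Sum.inr ((Rat.HeightOneSpectrum.primesEquiv (R := 𝓞 ℚ)).symm ⟨p, Fact.out⟩) : NumberField.Place ℚ))) < 1 from LocalField.valuation_adicCompletion_natCast_lt_one ((Rat.HeightOneSpectrum.primesEquiv (R := 𝓞 ℚ)).symm ⟨p, Fact.out⟩) p ((natCast_mem_asIdeal_iff_eq_primesEquiv_symm _ (Fact.out : p.Prime)).mpr rfl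))⟩
    haveI := isAdicComplete_integerC_natCast (show valuation (NumberField.Place.Completion (Sum.inr ((Rat.HeightOneSpectrum.primesEquiv (R := 𝓞 ℚ)).symm ⟨p, Fact.out⟩) : NumberField.Place ℚ)) ((p : ℕ) : (NumberField.Place.Completion (Sum.inr ((Rat.HeightOneSpectrum.primesEquiv (R := 𝓞 ℚ)).symm ⟨p, Fact.out⟩) : NumberField.Place ℚ))) < 1 from LocalField.valuation_adicCompletion_natCast_lt_one ((Rat.HeightOneSpectrum.primesEquiv (R := 𝓞 ℚ)).symm ⟨p, Fact.out⟩) p ((natCast_mem_asIdeal_iff_eq_primesEquiv_symm _ (Fact.out : p.Prime)).mpr rfl))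
    -- the tree's `ℚ`-algebra structure on `ℚ_v` (the one W2's restricted representations are built on) is pinned
    -- as the most recent local instance, so that it — and not `DivisionRing.toRatAlgebra` — is synthesized below
    letI : Algebra ℚ (NumberField.Place.Completion (Sum.inr ((Rat.HeightOneSpectrum.primesEquiv (R := 𝓞 ℚ)).symm ⟨p, Fact.out⟩) : NumberField.Place ℚ)) := NumberField.Place.instAlgebraCompletion (Sum.inr ((Rat.HeightOneSpectrum.primesEquiv (R := 𝓞 ℚ)).symm ⟨p, Fact.out⟩) : NumberField.Place ℚ)
    Kato2004.DefinedExpStarBody W p f₂ (d.smul e he) ι₂ κ₂ Λ₂ →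
    (∃ η₀ : contOneCocycles ρT.toTopRep, expStarCoord W (show valuation (NumberField.Place.Completion (Sum.inr ((Rat.HeightOneSpectrum.primesEquiv (R := 𝓞 ℚ)).symm ⟨p, Fact.out⟩) : NumberField.Place ℚ)) ((p : ℕ) : (NumberField.Place.Completion (Sum.inr ((Rat.HeightOneSpectrum.primesEquiv (R := 𝓞 ℚ)).symm ⟨p, Fact.out⟩) : NumberField.Place ℚ))) < 1 from LocalField.valuation_adicCompletion_natCast_lt_one ((Rat.HeightOneSpectrum.primesEquiv (R := 𝓞 ℚ)).symm ⟨p, Fact.out⟩) p ((natCast_mem_asIdeal_iff_eq_primesEquiv_symm _ (Fact.out : p.Prime)).mpr rfl)) d η₀ ≠ 0) →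
    ∀ (k : ℕ) (y : H1 (tateRep W p) (cycSubgroup p k ∅)),
      Λ₂ k ∅ y = ((Padic.adicCompletionEquiv (𝓞 ℚ) ⟨p, Fact.out⟩).symm
        (show (((Rat.HeightOneSpectrum.primesEquiv (R := 𝓞 ℚ)).symm ⟨p, Fact.out⟩).adicCompletion ℚ) from e))⁻¹ • Λ₁ k ∅ y := by
  intro h₂ hnd k y
  obtain ⟨η₀, hη₀⟩ := hnd
  -- the semi-local algebra at the level `m = p^k`
  obtain ⟨Ψ, hΨ⟩ := exists_padicTensorAlgEquiv (CyclotomicField (cycLevel p k ∅) ℚ) p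
  have hΨ' : ∀ (s : ℚ_[p]) (x : CyclotomicField (cycLevel p k ∅) ℚ)
      (w : ((Rat.HeightOneSpectrum.primesEquiv (R := 𝓞 ℚ)).symm ⟨p, Fact.out⟩).Extension (𝓞 (CyclotomicField (cycLevel p k ∅) ℚ))),
      Ψ.toAlgHom (s ⊗ₜ[ℚ] x) w =
        algebraMap (CyclotomicField (cycLevel p k ∅) ℚ) (w.1.adicCompletion (CyclotomicField (cycLevel p k ∅) ℚ)) x *
          algebraMap (((Rat.HeightOneSpectrum.primesEquiv (R := 𝓞 ℚ)).symm ⟨p, Fact.out⟩).adicCompletion ℚ)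
            (w.1.adicCompletion (CyclotomicField (cycLevel p k ∅) ℚ)) (Padic.adicCompletionEquiv (𝓞 ℚ) ⟨p, Fact.out⟩ s) :=
    fun s x w => hΨ s x w
  -- the two (RES)/(DEF) packages at this level, at the ONE place `w₀`
  obtain ⟨hdef₁, hz₁⟩ := h₁
  obtain ⟨hdef₂, hz₂⟩ := h₂
  obtain ⟨w₀, g₁, hg₁, hrest₁⟩ := hdef₁ k ∅ Ψ hΨ
  obtain ⟨w₀', g₂, hg₂, hrest₂⟩ := hdef₂ k ∅ Ψ hΨ
  haveI hsub := subsingleton_extension_cyclotomicField_primePow p k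
  obtain rfl : w₀ = w₀' := Subsingleton.elim _ _
  have hw₀ : ((p : ℕ) : 𝓞 (CyclotomicField (cycLevel p k ∅) ℚ)) ∈ w₀.1.asIdeal :=
    natCast_mem_asIdeal_of_extension p _ ((natCast_mem_asIdeal_iff_eq_primesEquiv_symm _ (Fact.out : p.Prime)).mpr rfl) w₀
  haveI : CharZero (w₀.1.adicCompletion (CyclotomicField (cycLevel p k ∅) ℚ)) := LocalField.charZero_adicCompletion w₀.1
  have hL : valuation (w₀.1.adicCompletion (CyclotomicField (cycLevel p k ∅) ℚ))
      ((p : ℕ) : w₀.1.adicCompletion (CyclotomicField (cycLevel p k ∅) ℚ)) < 1 :=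
    LocalField.valuation_adicCompletion_natCast_lt_one w₀.1 p hw₀
  haveI : Fact (¬ IsUnit ((p : ℕ) : integerC (w₀.1.adicCompletion (CyclotomicField (cycLevel p k ∅) ℚ)))) :=
    ⟨not_isUnit_natCast_integerC hL⟩
  haveI := isAdicComplete_integerC_natCast hL
  obtain ⟨dw₁, hRES₁, hDEF₁⟩ := hrest₁ hw₀ hL
  obtain ⟨dw₂, hRES₂, hDEF₂⟩ := hrest₂ hw₀ hL
  letI := LocalField.adicCompletionPadicAlgebra w₀.1 p hw₀
  -- (C3a) for both value data, from a family of each datum at the guarded parameters `(1, 1, 0, 1)`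
  have hg11 : Int.gcd 1 (6 * p * 1) = 1 := Int.gcd_one_left _
  have hg12 : Int.gcd 1 (6 * p * N₁) = 1 := Int.gcd_one_left _
  have hg22 : Int.gcd 1 (6 * p * N₂) = 1 := Int.gcd_one_left _
  obtain ⟨_, _, hb₁⟩ := hz₁ 1 1 0 1 one_pos hg11 hg12
  obtain ⟨_, _, hb₂⟩ := hz₂ 1 1 0 1 one_pos hg11 hg22
  have hC₁ := hb₁.2.2.1 k ∅
  have hC₂ := hb₂.2.2.1 k ∅
  -- a cocycle of the class `y` and its tower cocycle at `L_{w₀}` (the SAME for both data)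
  obtain ⟨φ, hφ⟩ := oneCocycleClass_surjective _ y
  obtain ⟨ψT, hψT⟩ := exists_towerCocycle W p k w₀ φ
  -- g-ELIMINATION: `Ψ(Λᵢ y)_{w₀} = exp*_{d_{w₀},i}(ψT)` for both data
  have key : ∀ (g : ((Rat.HeightOneSpectrum.primesEquiv (R := 𝓞 ℚ)).symm ⟨p, Fact.out⟩).Extension (𝓞 (CyclotomicField (cycLevel p k ∅) ℚ)) → absoluteGaloisGroup ℚ)
      (hg : ∀ w : ((Rat.HeightOneSpectrum.primesEquiv (R := 𝓞 ℚ)).symm ⟨p, Fact.out⟩).Extension (𝓞 (CyclotomicField (cycLevel p k ∅) ℚ)),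
        sigma (cycLevel p k ∅) (modNCyclotomicCharacter ℚ (cycLevel p k ∅) (g w)) • w.1 = w₀.1)
      (Λ : ∀ (k' : ℕ) (r : Finset (HeightOneSpectrum (𝓞 ℚ))),
        H1 (tateRep W p) (cycSubgroup p k' r) →ₗ[ℤ_[p]] ℚ_[p] ⊗[ℚ] CyclotomicField (cycLevel p k' r) ℚ)
      (hC : ∀ (σ : absoluteGaloisGroup ℚ) (y : H1 (tateRep W p) (cycSubgroup p k ∅)),
        Λ k ∅ (conjMap (tateRep W p).toTopRep (cycSubgroup p k ∅) σ 1 y) =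
          Algebra.TensorProduct.map (AlgHom.id ℚ ℚ_[p])
            (sigma (cycLevel p k ∅) (modNCyclotomicCharacter ℚ (cycLevel p k ∅) σ) :
              CyclotomicField (cycLevel p k ∅) ℚ →ₐ[ℚ] CyclotomicField (cycLevel p k ∅) ℚ) (Λ k ∅ y))
      (dw : (bdRPeriodRingData hL).FilZeroLine
        ((W.rationalTateGaloisRep p (W.continuous_rationalGaloisRepTate_holds p)).restrict
          ((absGaloisRestrict ℚ (NumberField.Place.Completion (Sum.inr ((Rat.HeightOneSpectrum.primesEquiv (R := 𝓞 ℚ)).symm ⟨p, Fact.out⟩) : NumberField.Place ℚ))).comp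
            (absGaloisRestrict (((Rat.HeightOneSpectrum.primesEquiv (R := 𝓞 ℚ)).symm ⟨p, Fact.out⟩).adicCompletion ℚ) (w₀.1.adicCompletion (CyclotomicField (cycLevel p k ∅) ℚ))))))
      (hDEF : ∀ (w : ((Rat.HeightOneSpectrum.primesEquiv (R := 𝓞 ℚ)).symm ⟨p, Fact.out⟩).Extension (𝓞 (CyclotomicField (cycLevel p k ∅) ℚ)))
          (y : H1 (tateRep W p) (cycSubgroup p k ∅))
          (φ'' : contOneCocycles (subgroupRep (tateRep W p).toTopRep (cycSubgroup p k ∅)))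
          (ψT : contOneCocycles ((restrictedTateRep W (NumberField.Place.Completion (Sum.inr ((Rat.HeightOneSpectrum.primesEquiv (R := 𝓞 ℚ)).symm ⟨p, Fact.out⟩) : NumberField.Place ℚ)) p).restrict
            (absGaloisRestrict (((Rat.HeightOneSpectrum.primesEquiv (R := 𝓞 ℚ)).symm ⟨p, Fact.out⟩).adicCompletion ℚ) (w₀.1.adicCompletion (CyclotomicField (cycLevel p k ∅) ℚ)))).toTopRep),
          oneCocycleClass _ φ'' = conjMap (tateRep W p).toTopRep (cycSubgroup p k ∅) (g w) 1 y →
          (∀ σ, ψT.1 σ = φ''.1 ⟨absGaloisRestrictTower ℚ (((Rat.HeightOneSpectrum.primesEquiv (R := 𝓞 ℚ)).symm ⟨p, Fact.out⟩).adicCompletion ℚ) (w₀.1.adicCompletion (CyclotomicField (cycLevel p k ∅) ℚ)) σ,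
            absGaloisRestrictTower_cyclotomicField_adicCompletion_mem_cycSubgroup p k ∅ ((Rat.HeightOneSpectrum.primesEquiv (R := 𝓞 ℚ)).symm ⟨p, Fact.out⟩) w₀ σ⟩) →
          Ψ (Λ k ∅ y) w = galAdicCompletionMap
            (sigma (cycLevel p k ∅) (modNCyclotomicCharacter ℚ (cycLevel p k ∅) (g w)))⁻¹
            (inv_smul_eq_of_smul_eq (hg w))
            ((bdRPeriodRingData hL).dualExpCoord (logCyclotomic p)
              ((W.rationalTateGaloisRep p (W.continuous_rationalGaloisRepTate_holds p)).restrict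
            ((absGaloisRestrict ℚ (NumberField.Place.Completion (Sum.inr ((Rat.HeightOneSpectrum.primesEquiv (R := 𝓞 ℚ)).symm ⟨p, Fact.out⟩) : NumberField.Place ℚ))).comp
              (absGaloisRestrict (((Rat.HeightOneSpectrum.primesEquiv (R := 𝓞 ℚ)).symm ⟨p, Fact.out⟩).adicCompletion ℚ) (w₀.1.adicCompletion (CyclotomicField (cycLevel p k ∅) ℚ)))))
              dw.ω (fun σ => TateModule.toRational p (ψT.1 σ)))),
      Ψ (Λ k ∅ y) w₀ = (bdRPeriodRingData hL).dualExpCoord (logCyclotomic p)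
          ((W.rationalTateGaloisRep p (W.continuous_rationalGaloisRepTate_holds p)).restrict
            ((absGaloisRestrict ℚ (NumberField.Place.Completion (Sum.inr ((Rat.HeightOneSpectrum.primesEquiv (R := 𝓞 ℚ)).symm ⟨p, Fact.out⟩) : NumberField.Place ℚ))).comp
              (absGaloisRestrict (((Rat.HeightOneSpectrum.primesEquiv (R := 𝓞 ℚ)).symm ⟨p, Fact.out⟩).adicCompletion ℚ) (w₀.1.adicCompletion (CyclotomicField (cycLevel p k ∅) ℚ)))))
          dw.ω (fun σ => TateModule.toRational p (ψT.1 σ)) := by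
    intro g hg Λ hC dw hDEF
    set G : absoluteGaloisGroup ℚ := g w₀ with hG
    set τ := sigma (cycLevel p k ∅) (modNCyclotomicCharacter ℚ (cycLevel p k ∅) G) with hτ
    set Y := conjMap (tateRep W p).toTopRep (cycSubgroup p k ∅) G⁻¹ 1 y with hY
    have hYy : conjMap (tateRep W p).toTopRep (cycSubgroup p k ∅) G 1 Y = y := by
      rw [hY, ← conjMap_mul_apply_one, mul_inv_cancel]
      exact conjMap_one_apply_of_mem (tateRep W p).toTopRep (cycSubgroup p k ∅) (1 : cycSubgroup p k ∅) y
    have hφ' : oneCocycleClass _ φ = conjMap (tateRep W p).toTopRep (cycSubgroup p k ∅) (g w₀) 1 Y := by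
      rw [← hG, hYy]; exact hφ
    have hD := hDEF w₀ Y φ ψT hφ' hψT
    have hCY := hC G Y
    rw [hYy] at hCY
    have hgal := padicTensor_map_galois Ψ.toAlgHom hΨ' τ w₀ w₀ (hg w₀) (Λ k ∅ Y)
    simp only [AlgEquiv.coe_toAlgHom] at hgal
    have h3 := congrArg (fun x => galAdicCompletionMap (L := CyclotomicField (cycLevel p k ∅) ℚ) τ (hg w₀) x) hD
    simp only at h3
    rw [galAdicCompletionMap_galAdicCompletionMap] at h3
    rw [galAdicCompletionMap_congr_left _ (mul_inv_cancel τ) _ (one_smul _ _)] at h3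
    rw [galAdicCompletionMap_one] at h3
    rw [hCY]
    rw [hgal]
    exact h3
  have key₁ := key g₁ hg₁ Λ₁ hC₁ dw₁ hDEF₁
  have key₂ := key g₂ hg₂ Λ₂ hC₂ dw₂ hDEF₂
  -- the two tower generators differ by a scalar `μ`, pinned to `e` by (RES) on the non-degenerate cocycle
  obtain ⟨μ, hμ0, hμ⟩ := dw₁.exists_ne_zero_and_eq_smul dw₂
  obtain ⟨η, hη⟩ := exists_cocycle_restrict
    (restrictedTateRep W (NumberField.Place.Completion (Sum.inr ((Rat.HeightOneSpectrum.primesEquiv (R := 𝓞 ℚ)).symm ⟨p, Fact.out⟩) : NumberField.Place ℚ)) p)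
    (absGaloisRestrict (((Rat.HeightOneSpectrum.primesEquiv (R := 𝓞 ℚ)).symm ⟨p, Fact.out⟩).adicCompletion ℚ) (w₀.1.adicCompletion (CyclotomicField (cycLevel p k ∅) ℚ))) η₀
  have hR₁ := hRES₁ η₀ η hη
  have hR₂ := hRES₂ η₀ η hη
  set eL := algebraMap (((Rat.HeightOneSpectrum.primesEquiv (R := 𝓞 ℚ)).symm ⟨p, Fact.out⟩).adicCompletion ℚ) (w₀.1.adicCompletion (CyclotomicField (cycLevel p k ∅) ℚ)) e with heL
  have heL0 : eL ≠ 0 := (_root_.map_ne_zero _).mpr he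
  have hX0 := (_root_.map_ne_zero (algebraMap (((Rat.HeightOneSpectrum.primesEquiv (R := 𝓞 ℚ)).symm ⟨p, Fact.out⟩).adicCompletion ℚ)
    (w₀.1.adicCompletion (CyclotomicField (cycLevel p k ∅) ℚ)))).mpr hη₀
  rw [hμ, FilZeroLine.dualExpCoord_smul dw₁ hμ0, hR₁, expStarCoord_smul_generator, map_mul, map_inv₀] at hR₂
  -- `μ⁻¹ · X = e⁻¹ · X`, `X ≠ 0`
  have hμe : μ = eL := by
    have h := mul_right_cancel₀ hX0 hR₂
    rw [heL]
    exact inv_injective h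
  -- the values at `w₀`
  have hw₀val : Ψ (Λ₂ k ∅ y) w₀ = eL⁻¹ * Ψ (Λ₁ k ∅ y) w₀ := by
    rw [key₂, key₁, hμ, FilZeroLine.dualExpCoord_smul dw₁ hμ0, hμe]
  -- `Ψ(ẽ⁻¹ • Λ₁ y)_{w₀} = e⁻¹ · Ψ(Λ₁ y)_{w₀}`
  have hsm := padicTensor_map_smul Ψ.toAlgHom hΨ'
    ((Padic.adicCompletionEquiv (𝓞 ℚ) ⟨p, Fact.out⟩).symm
      (show (((Rat.HeightOneSpectrum.primesEquiv (R := 𝓞 ℚ)).symm ⟨p, Fact.out⟩).adicCompletion ℚ) from e))⁻¹ (Λ₁ k ∅ y) w₀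
  simp only [AlgEquiv.coe_toAlgHom, map_inv₀, ContinuousAlgEquiv.apply_symm_apply] at hsm
  -- conclude on all places (`w₀` is the only one) and by the injectivity of `Ψ`
  apply Ψ.injective
  funext w
  obtain rfl : w₀ = w := Subsingleton.elim _ _
  rw [hw₀val, heL]
  exact hsm.symm

end Rigid

end Summit.BirchSwinnertonDyer.Rank1Residual.Additive.PerrinRiouUnit

end
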